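import Literature.NumberTheory.Sieve.QuadraticRootsPrimeModuliDFI
import Literature.NumberTheory.Sieve.SieveFramework
import HarnessLib

/-!
# Duke–Friedlander–Iwaniec 1995, §6: the sieve objects for complex sequences (Buchstab, Legendre)

Topic `Literature/NumberTheory/Sieve`.  First layer towards the discharge of the named fact
`Literature.NumberTheory.Sieve.dukeFriedlanderIwaniec1995_theorem5` (DFI's Theorem 5, the sieve
producing `∑_{p ≤ x} c_p ≪ ε π(x)` from the bilinear-form hypotheses (34)–(35), vendored in
`QuadraticRootsPrimeModuliDFI.lean`): the objects of §6 of W. Duke, J. B. Friedlander, H. Iwaniec,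
*Equidistribution of roots of a quadratic congruence to prime moduli*, Ann. of Math. 141 (1995),
pp. 433–437, for COMPLEX sequences, and the two finite identities the section is built from,
PROVED:

* `DFI1995.sifted c x z = S(C, z) = ∑_{1 ≤ n ≤ x, (n, P(z)) = 1} c_n` (`P(z) = ∏_{p<z} p` is the
  tree's `primesProdBelow`), `DFI1995.restrictSeq c d = C_d` (`c_n 1_{d ∣ n}`) and
  `DFI1995.multSum c x d = |C_d| = ∑_{n ≤ x, d ∣ n} c_n`;
* **Buchstab's identity** for complex sequences, in the two-parameter form used on p. 434:
  `S(C, z) = S(C, w) − ∑_{w ≤ p < z} S(C_p, p)` for `w ≤ z` (`DFI1995.sifted_buchstab`), from the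
  one-parameter form `S(C, z) = |C_1| − ∑_{p < z} S(C_p, p)` (`DFI1995.sifted_eq_total_sub`; the
  classification of `n` by its least prime factor, as in the tree's `SieveSequence.buchstab_identity`
  for nonnegative real sequences);
* **Legendre's identity** `S(C, w) = ∑_{d ∣ P(w)} μ(d) |C_d|` (`DFI1995.sifted_eq_sum_moebius`).

Both identities are finite and hold for every sequence; the tree's sieve framework
(`SieveFramework.lean`) states them for `SieveSequence` (nonnegative real weights with density
data), which does not cover the complex sequences `c_n = ρ_h(n)/C_f` of DFI's §7, hence this
restatement over an arbitrary additive commutative group of values.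

## §6 of the paper as printed (pp. 433–437; the material a proof of Theorem 5 must follow)

Let `C = {c_n}` be complex numbers with `∑ |c_n| < ∞`; `z ≥ 2`, `P(z)` the product of the primes
`< z`, `S(C, z) = ∑_{(n,P(z))=1} c_n`, `C_d = {c_n : n ≡ 0 (mod d)}`, `|C_d| = ∑_{n ≡ 0 (d)} c_n`.
Buchstab twice: `S(C,z) = S(C,w) − ∑_{w≤p<z} S(C_p,w) + ∑∑_{w≤p<q<z} S(C_pq,p)` (`w < z`); Legendre:
`S(C,w) − ∑_{w≤p<z} S(C_p,w) = ∑^w_{d∣P(z)} μ(d)|C_d|`, `∑^w` restricting `d` to integers with at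
most one prime factor `≥ w`.  With points `w = y_K < … < y_1 < y_0 = y < z`, for `y_{k+1} ≤ p < y_k`
split `∑∑_{p<q<z} S(C_pq,p) = ∑∑_{y_{k+1}≤p<q<y_k} + ∑∑_{y_{k+1}≤p<y_k≤q<z}` and in the second use
`S(C_pq,p) = S(C_pq,y_k) + ∑_{p≤r<y_k} S(C_pqr,r)`.
**Lemma 1** (26): `S(C,z) − ∑∑_{y≤p<q<z} S(C_pq,p) = ∑^w_{d∣P(z)} μ(d)|C_d|
 + ∑_{0≤k<K} ∑∑_{y_{k+1}≤p<y_k≤q<z} S(C_pq,y_k) + ∑_{0≤k<K} {∑∑_{y_{k+1}≤p<q<y_k} S(C_pq,p) + ∑∑∑_{y_{k+1}≤p≤r<y_k≤q<z} S(C_pqr,r)}`.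
Crude bound (27): `∑_{n≡0(d)} |c_n| ≤ γ(d)X`, `X > 0`, `γ ≥ 0` submultiplicative; then
`|∑^w_{d≥D}| ≤ 2^{−log(D/z)/log w} G²(z) X` with (28) `G(z) = ∏_{p<z}(1+γ(p))` (choosing
`ε = log 2/log w`), and the last two sums of (26) are `≤ X(∑_{y_{k+1}≤p<y_k} γ(p))²` and
`≤ X(∑_{y_{k+1}≤q<z} γ(q))(∑_{y_{k+1}≤p<y_k} γ(p))²`; with `1 + ∑_{y_{k+1}≤q<z} γ(q) ≤ G(z)` they total
`≤ Δ X G²(z)`, `Δ = max_k ∑_{y_{k+1}≤p<y_k} γ(p)`.  Assuming (29) `γ(p) ≤ c p^{−1}`: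
`G(z) ≪ (log z)^c`, `∑_{y_{k+1}≤p<y_k} γ(p) ≤ c(w^{−1} + log(y_k/y_{k+1}))`; with (30)
`y_k = y (w/y)^{k/K}` and `3 ≤ K ≤ w`: `Δ ≤ cK^{−1} log y`.
**Lemma 2** (31): for `3 ≤ K ≤ w < y < z < D`, (27) and (29):
`S(C,z) − ∑∑_{y≤p<q<z} S(C_pq,p) = ∑^w_{d∣P(z), d<D} μ(d)|C_d| + ∑_{0≤k<K} ∑∑_{y_{k+1}≤p<y_k<q<z} S(C_pq,y_k) + θ X G(z)² (2^{−log(D/z)/log w} + cK^{−1} log y)`,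
`|θ| ≤ 1`.  The first sum is estimated by the special bilinear forms (32) `R(D) = ∑_{d<D} λ_d ∑_m c_{dm}`,
the others by (33) `R(w,y) = ∑_{w≤n<y} β_n ∑_{(m,n)=1} α_m c_{mn}`, `|α_m| ≤ ω(m)`, `|β_n| ≤ 1`,
`|λ_d| ≤ 1`, `β_n` on primes.  For `c_n` on `n ≤ x` with `|c_n| ≤ τ(n)`: (27) with `γ(d) = τ(d)d^{−1}`,
`X ≪ x log x`; choose `K = (log x)^8`, `w = x^{(log log x)^{−3}}`, `D = z x^{(log log x)^{−1}}`.
**Lemma 3** (36): if (34) `R(D) ≪ x(log x)^{−2}` and (35) `R(w,y) ≪ x(log x)^{−10}` then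
`S(C,z) = ∑∑_{y≤p<q<z} S(C_pq,p) + O(x(log x)^{−2})`.  If `y = x^{1/3−ε}` then, as long as
`z ≤ x^{1/2−ε}`, `∑∑_{y≤p<q<z} S(C_pq,p) ≪ ∑_{y≤p<x^{1/3}} (x/p)(log(x/p))^{−1} ≪ εx/log x`; if
`z = x^{1/2−ε}` then `S(C,z) = ∑_{z≤p≤x} c_p + O(∑_{z≤p<x^{1/2}} (x/p)(log(x/p))^{−1}) = ∑_{p≤x} c_p + O(εx/log x)`.
**Theorem 5** (37): (34) with `D = x^{1/2−ε}` and (35) with `y = x^{1/3−ε}`, `w = x^{(log log x)^{−3}}`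
give `∑_{p≤x} c_p ≪ ε π(x)` for `x > x₀(ε)`, the implied constant absolute.
(Transcribed from the page images of the author-hosted scan, acq-00842; the scan's text layer
carries the prose of these pages but garbles the displayed formulas.)

## References

* W. Duke, J. B. Friedlander, H. Iwaniec, Ann. of Math. (2) 141 (1995), 423–441, §6 pp. 433–437.
  [cite: DukeFriedlanderIwaniec1995, §6 Lemmas 1–3 and Theorem 5]
-/

namespace Literature.NumberTheory.Sieve

open scoped BigOperators
open Finset

namespace DFI1995

variable {M : Type*} [AddCommGroup M]

/-! ### The objects -/

/-- `S(C, z) = ∑_{1 ≤ n ≤ x, (n, P(z)) = 1} c_n`, the sifted sum of a sequence `c` (values in any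
additive commutative group; in the paper, complex numbers supported on `n ≤ x`), `P(z) = ∏_{p<z} p`
(`primesProdBelow z`). [cite: DukeFriedlanderIwaniec1995, §6 p. 434] -/
noncomputable def sifted (c : ℕ → M) (x z : ℝ) : M :=
  ∑ n ∈ (Ioc 0 ⌊x⌋₊).filter (fun n : ℕ => Nat.Coprime n (primesProdBelow z)), c n

/-- The subsequence `C_d = {c_n : n ≡ 0 (mod d)}` as a sequence (`0` off the multiples of `d`).
[cite: DukeFriedlanderIwaniec1995, §6 p. 434] -/
def restrictSeq (c : ℕ → M) (d : ℕ) : ℕ → M := fun n => if d ∣ n then c n else 0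

/-- `|C_d| = ∑_{1 ≤ n ≤ x, d ∣ n} c_n`. [cite: DukeFriedlanderIwaniec1995, §6 p. 434] -/
noncomputable def multSum (c : ℕ → M) (x : ℝ) (d : ℕ) : M :=
  ∑ n ∈ (Ioc 0 ⌊x⌋₊).filter (fun n : ℕ => d ∣ n), c n

/-- Unfolding `restrictSeq`. [folklore] -/
@[simp] theorem restrictSeq_apply (c : ℕ → M) (d n : ℕ) :
    restrictSeq c d n = if d ∣ n then c n else 0 := rfl

/-- `C_1 = C`. [folklore] -/
@[simp] theorem restrictSeq_one (c : ℕ → M) : restrictSeq c 1 = c := by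
  funext n; simp [restrictSeq]

/-- `(C_d)_e = C_{de}` for coprime `d, e`. [folklore] -/
theorem restrictSeq_restrictSeq {d e : ℕ} (h : Nat.Coprime d e) (c : ℕ → M) :
    restrictSeq (restrictSeq c d) e = restrictSeq c (d * e) := by
  funext n
  simp only [restrictSeq_apply]
  by_cases hde : d * e ∣ n
  · rw [if_pos hde, if_pos (dvd_trans (dvd_mul_left e d) hde), if_pos (dvd_trans (dvd_mul_right d e) hde)]
  · rw [if_neg hde]
    by_cases he : e ∣ n
    · rw [if_pos he, if_neg (fun hd => hde (h.mul_dvd_of_dvd_of_dvd hd he))]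
    · rw [if_neg he]

/-- `|C_d| = ∑_{n ≤ x} (C_d)_n`. [folklore] -/
theorem multSum_eq_sum_restrictSeq (c : ℕ → M) (x : ℝ) (d : ℕ) :
    multSum c x d = ∑ n ∈ Ioc 0 ⌊x⌋₊, restrictSeq c d n := by
  unfold multSum; rw [Finset.sum_filter]; rfl

/-- `S(C, z)` for `z ≤ 2` sifts nothing: `S(C, z) = ∑_{n ≤ x} c_n`. [folklore] -/
theorem sifted_of_le_two (c : ℕ → M) (x : ℝ) {z : ℝ} (hz : z ≤ 2) :
    sifted c x z = ∑ n ∈ Ioc 0 ⌊x⌋₊, c n := by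
  unfold sifted
  have hP : primesProdBelow z = 1 := by
    unfold primesProdBelow
    have : Nat.primesBelow ⌈z⌉₊ = ∅ := by
      have h2 : ⌈z⌉₊ ≤ 2 := Nat.ceil_le.2 (by exact_mod_cast hz)
      ext p
      simp only [Nat.mem_primesBelow, Finset.notMem_empty, iff_false, not_and]
      intro hp hpp
      exact absurd (lt_of_lt_of_le hp h2) (not_lt.2 hpp.two_le)
    rw [this, Finset.prod_empty]
  rw [hP]
  congr 1
  exact Finset.filter_true_of_mem fun n _ => Nat.coprime_one_right n

/-! ### Buchstab's identity -/

/-- **Buchstab's identity, one-parameter form**: `S(C, z) = ∑_{n ≤ x} c_n − ∑_{p < z} S(C_p, p)`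
(classify `n` with `(n, P(z)) ≠ 1` by its least prime factor `p = minFac n < z`; cf. the tree's
`SieveSequence.buchstab_identity` for nonnegative real sequences). [folklore] -/
theorem sifted_eq_total_sub (c : ℕ → M) (x z : ℝ) :
    sifted c x z = (∑ n ∈ Ioc 0 ⌊x⌋₊, c n) -
      ∑ p ∈ Nat.primesBelow ⌈z⌉₊, sifted (restrictSeq c p) x p := by
  rw [eq_sub_iff_add_eq, sifted, ← Finset.sum_filter_add_sum_filter_not (Ioc 0 ⌊x⌋₊)
    (fun n : ℕ => n.Coprime (primesProdBelow z)) c]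
  congr 1
  have hminmem : ∀ n : ℕ, ¬ n.Coprime (primesProdBelow z) → n.minFac ∈ Nat.primesBelow ⌈z⌉₊ := by
    intro n hn
    rw [coprime_primesProdBelow_iff] at hn
    simp only [not_forall, not_not] at hn
    obtain ⟨q, hq, hqn⟩ := hn
    rw [Nat.mem_primesBelow] at hq ⊢
    have hn1 : n ≠ 1 := fun h1 => hq.2.ne_one (Nat.dvd_one.mp (h1 ▸ hqn))
    exact ⟨(Nat.minFac_le_of_dvd hq.2.two_le hqn).trans_lt hq.1, Nat.minFac_prime hn1⟩
  have key : ∀ p ∈ Nat.primesBelow ⌈z⌉₊, sifted (restrictSeq c p) x p =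
      ∑ n ∈ Ioc 0 ⌊x⌋₊,
        if ¬ n.Coprime (primesProdBelow z) ∧ n.minFac = p then c n else 0 := by
    intro p hp
    have hpp : p.Prime := Nat.prime_of_mem_primesBelow hp
    rw [sifted, Finset.sum_filter]
    refine Finset.sum_congr rfl fun n _ => ?_
    simp only [restrictSeq_apply]
    have hcp : n.Coprime (primesProdBelow p) ↔ ∀ q ∈ Nat.primesBelow p, ¬ q ∣ n := by
      rw [coprime_primesProdBelow_iff, Nat.ceil_natCast]
    by_cases H : ¬ n.Coprime (primesProdBelow z) ∧ n.minFac = p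
    · obtain ⟨H1, rfl⟩ := H
      have hgood : n.Coprime (primesProdBelow (n.minFac : ℕ)) := by
        refine hcp.mpr fun q hq hqn => ?_
        rw [Nat.mem_primesBelow] at hq
        exact (Nat.not_lt.mpr (Nat.minFac_le_of_dvd hq.2.two_le hqn)) hq.1
      rw [if_pos hgood, if_pos (Nat.minFac_dvd n), if_pos (show ¬ _ ∧ _ from ⟨H1, rfl⟩)]
    · rw [if_neg H]
      split_ifs with h1 h2 <;> try rfl
      exfalso
      apply H
      have hn1 : n ≠ 1 := fun h => hpp.ne_one (Nat.dvd_one.mp (h ▸ h2))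
      have hmin : n.minFac = p := by
        rcases (Nat.minFac_le_of_dvd hpp.two_le h2).lt_or_eq with hlt | heq
        · exact absurd (Nat.minFac_dvd n)
            (hcp.mp h1 _ (Nat.mem_primesBelow.mpr ⟨hlt, Nat.minFac_prime hn1⟩))
        · exact heq
      refine ⟨fun hc => ?_, hmin⟩
      rw [coprime_primesProdBelow_iff] at hc
      exact hc p hp h2
  rw [Finset.sum_congr rfl key, Finset.sum_comm, Finset.sum_filter]
  refine Finset.sum_congr rfl fun n _ => ?_
  by_cases hc : n.Coprime (primesProdBelow z)
  · simp [hc]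
  · simp only [hc, not_false_eq_true, true_and]
    rw [Finset.sum_ite_eq]
    simp [hminmem n hc]

/-- The primes `w ≤ p < z` as a `Finset`: `primesBelow ⌈z⌉₊` minus `primesBelow ⌈w⌉₊`. [folklore] -/
theorem primesBelow_ceil_sdiff (w z : ℝ) :
    Nat.primesBelow ⌈z⌉₊ \ Nat.primesBelow ⌈w⌉₊ =
      (Nat.primesBelow ⌈z⌉₊).filter (fun p : ℕ => w ≤ (p : ℝ)) := by
  ext p
  simp only [Finset.mem_sdiff, Nat.mem_primesBelow, Finset.mem_filter, not_and, Nat.lt_ceil]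
  constructor
  · rintro ⟨⟨h1, h2⟩, h3⟩
    exact ⟨⟨h1, h2⟩, not_lt.1 fun h => h3 h h2⟩
  · rintro ⟨⟨h1, h2⟩, h3⟩
    exact ⟨⟨h1, h2⟩, fun h _ => absurd h (not_lt.2 h3)⟩

/-- **Buchstab's identity, two-parameter form** (the form iterated on p. 434):
`S(C, z) = S(C, w) − ∑_{w ≤ p < z} S(C_p, p)` for `w ≤ z`.
[cite: DukeFriedlanderIwaniec1995, §6 p. 434] -/
theorem sifted_buchstab (c : ℕ → M) (x : ℝ) {w z : ℝ} (hwz : w ≤ z) :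
    sifted c x z = sifted c x w -
      ∑ p ∈ (Nat.primesBelow ⌈z⌉₊).filter (fun p : ℕ => w ≤ (p : ℝ)), sifted (restrictSeq c p) x p := by
  have hsub : Nat.primesBelow ⌈w⌉₊ ⊆ Nat.primesBelow ⌈z⌉₊ := by
    intro p hp
    rw [Nat.mem_primesBelow] at hp ⊢
    exact ⟨lt_of_lt_of_le hp.1 (Nat.ceil_mono hwz), hp.2⟩
  rw [sifted_eq_total_sub c x z, sifted_eq_total_sub c x w, ← primesBelow_ceil_sdiff,
    Finset.sum_sdiff_eq_sub hsub]
  abel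

/-- **Buchstab twice** (first display of p. 434): for `w ≤ z`,
`S(C,z) = S(C,w) − ∑_{w≤p<z} S(C_p,w) + ∑_{w≤p<z} ∑_{w≤q<p} S(C_pq,q)`
(the paper writes the double sum as `∑∑_{w≤p<q<z} S(C_pq,p)` after exchanging the names of `p`
and `q`; here `C_pq = (C_p)_q`). [cite: DukeFriedlanderIwaniec1995, §6 p. 434] -/
theorem sifted_buchstab_twice (c : ℕ → M) (x : ℝ) {w z : ℝ} (hwz : w ≤ z) :
    sifted c x z = sifted c x w -
      ∑ p ∈ (Nat.primesBelow ⌈z⌉₊).filter (fun p : ℕ => w ≤ (p : ℝ)), sifted (restrictSeq c p) x w +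
      ∑ p ∈ (Nat.primesBelow ⌈z⌉₊).filter (fun p : ℕ => w ≤ (p : ℝ)),
        ∑ q ∈ (Nat.primesBelow ⌈(p : ℝ)⌉₊).filter (fun q : ℕ => w ≤ (q : ℝ)),
          sifted (restrictSeq (restrictSeq c p) q) x q := by
  rw [sifted_buchstab c x hwz, sub_add, ← Finset.sum_sub_distrib]
  congr 1
  refine Finset.sum_congr rfl fun p hp => ?_
  have hwp : w ≤ (p : ℝ) := (Finset.mem_filter.1 hp).2
  rw [sifted_buchstab (restrictSeq c p) x hwp]

/-! ### Legendre's identity -/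

/-- `∑_{d ∣ m} μ(d) = [m = 1]` as an integer scalar acting on `M`. [folklore] -/
theorem sum_divisors_moebius_zsmul (m : ℕ) (v : M) :
    ∑ d ∈ m.divisors, (ArithmeticFunction.moebius d) • v = if m = 1 then v else 0 := by
  rw [← Finset.sum_smul]
  have h := congrArg (fun f : ArithmeticFunction ℤ => f m)
    (ArithmeticFunction.moebius_mul_coe_zeta)
  simp only [ArithmeticFunction.coe_mul_zeta_apply, ArithmeticFunction.one_apply] at h
  rw [h]
  split_ifs <;> simp

/-- **Legendre's identity**: `S(C, w) = ∑_{d ∣ P(w)} μ(d) |C_d|` (Möbius inversion over the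
divisors of the squarefree `P(w)`; finite, valid for every sequence).
[cite: DukeFriedlanderIwaniec1995, §6 p. 434] -/
theorem sifted_eq_sum_moebius (c : ℕ → M) (x w : ℝ) :
    sifted c x w = ∑ d ∈ (primesProdBelow w).divisors, (ArithmeticFunction.moebius d) • multSum c x d := by
  have hP : primesProdBelow w ≠ 0 := primesProdBelow_ne_zero w
  unfold sifted multSum
  simp_rw [Finset.sum_filter, Finset.smul_sum]
  rw [Finset.sum_comm]
  refine Finset.sum_congr rfl fun n _ => ?_
  -- `∑_{d ∣ P(w)} μ(d) [d ∣ n] c_n = [(n, P(w)) = 1] c_n`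
  have hrw : ∑ d ∈ (primesProdBelow w).divisors, (ArithmeticFunction.moebius d) • (if d ∣ n then c n else 0) =
      ∑ d ∈ (primesProdBelow w).divisors.filter (fun d => d ∣ n), (ArithmeticFunction.moebius d) • c n := by
    rw [Finset.sum_filter]
    refine Finset.sum_congr rfl fun d _ => ?_
    split_ifs <;> simp
  rw [hrw]
  have hset : (primesProdBelow w).divisors.filter (fun d => d ∣ n) = (Nat.gcd n (primesProdBelow w)).divisors := by
    ext d
    simp only [Finset.mem_filter, Nat.mem_divisors, Nat.dvd_gcd_iff, ne_eq, Nat.gcd_eq_zero_iff, not_and]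
    constructor
    · rintro ⟨⟨hdP, -⟩, hdn⟩; exact ⟨⟨hdn, hdP⟩, fun _ => hP⟩
    · rintro ⟨⟨hdn, hdP⟩, -⟩; exact ⟨⟨hdP, hP⟩, hdn⟩
  rw [hset, sum_divisors_moebius_zsmul]

end DFI1995

end Literature.NumberTheory.Sieve
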